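import Mathlib
import Summits.Ventures.PercRepro2.OneEdge
import Summits.Ventures.PercRepro2.KPrimeReduction
import Summits.Ventures.PercRepro2.KPrimeSure
import Summits.Ventures.PercRepro2.KPrimeVEdge
import Summits.Ventures.PercRepro2.KPrimeVYDict
import Summits.Ventures.PercRepro2.KPrimeVYEdge
import Summits.Ventures.PercRepro2.KPrimeCovSplit

/-!
# `(STEP-v)₁` is a theorem at every `v`-root edge of every instance with `P(Y ∩ S) = 0`
(blind cell PercRepro2, mine-c g36; `conjectures/MINE-C.md` §45.0, §45.3)

When `a₂` cannot reach the mark `y` inside `S = {a₂ ↮ a₁, a₂ ↮ v}`, the covariance term of the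
cleared `(K′)` form vanishes in the parent and in both worlds of an edge `e = {x, z}` from the root
of `v`, the form is `P(S)·(P((0,1)ᵉ)·D₀ − N₀·P((0,1)))`, and the weakest damped one-edge statement

  `(STEP-v)₁ :  (1 − t)·P(N)·P(S)·form(p[e ↦ 0]) ≤ P⁰(N)·P⁰(S)·form(p)`

reduces (an exact polynomial identity in the mixtures `M = t·M¹ + (1 − t)·M⁰`) to
`D₀⁰·(D₀·O1e¹ − N₀·O1¹) + (1 − t)·O1⁰·Λ ≥ 0` with `Λ = N₀⁰·D₀¹ − N₀¹·D₀⁰ ≥ 0` the lean drop.  It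
is paid by three signed facts: (i) world `1` at its own lean, `P¹((0,1) ∩ X)·P¹(N) ≥ P¹((0,1))·
P¹(X ∩ N)` (`bhk_part_ineq` at `p[e ↦ 1]`); (ii) the lean drop `Λ ≥ 0` (`lean_drop_ineq`, van den
Berg–Kahn); (iii) **the `(0,1)`-share of `N` does not rise when `z` joins the avoided set**:
`P((0,1) ∩ {a₁ ↮ z} ∩ {a₂ ↮ z})·P(N) ≤ P((0,1))·P(N ∩ {a₁ ↮ z})` (`cls01_drop_ineq` — again
`bhk_part_ineq`, now with the far end `z` in the role of `b`), the world-`1` masses being read as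
world-`0` masses through the flip dictionary (`prob_cls01_vfar`, `prob_N_vy`, `prob_XN_vy`).
So in the regime `P(Y ∩ S) = 0` both `(K′)` (`kprimeHolds_of_YS_eq_zero`) and its one-edge step
are theorems: this is the regime of the `R`-pockets of `MINE-C.md` §44.5–44.7.
-/

namespace Summit.Ventures.PercRepro2

namespace KPrime

variable {V : Type*} {E : Type*} [Fintype E] [DecidableEq E] [Fintype V] [DecidableEq V]
  {R : Type*} [Field R] [LinearOrder R] [IsStrictOrderedRing R]

section Dict

variable {ends : E → Sym2 V} {a₁ a₂ v y : V} {p : E → R} {e : E}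

omit [Fintype E] [Fintype V] [IsStrictOrderedRing R] in
/-- `(0,1)` with `e = {x, z}` open (`x` in the root of `v`) is `(0,1) ∩ {a₁ ↮ z} ∩ {a₂ ↮ z}` with
`e` closed. -/
lemma cls01_dict_vfar {x z : V} (hends : ends e = s(x, z)) (hx : x ∈ root p ends v)
    (he : p e ≠ 1) (ω : Config E) (hle : oneConfig p ≤ ω) :
    Function.update ω e true ∈ cls01 ends a₁ a₂ v y ↔
      Function.update ω e false ∈
        cls01 ends a₁ a₂ v y ∩ (connEvent ends a₁ z)ᶜ ∩ (connEvent ends a₂ z)ᶜ := by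
  set ω' := Function.update ω e false with hω'
  have hle' : oneConfig p ≤ ω' := oneConfig_le_update_false he hle
  have hvx : Conn ends ω' v x := conn_mono hle' hx
  have heq : Function.update ω e true = Function.update ω' e true := by
    simp [hω', Function.update_idem]
  rw [heq]
  have hvv : Conn ends ω' v v := conn_refl _ _ _
  simp only [cls01, Set.mem_inter_iff, Set.mem_compl_iff, mem_connEvent, mem_S,
    conn_update_true_iff_v hends hvx]
  constructor
  · rintro ⟨⟨h1, h2⟩, h3, h4⟩
    have h1z : ¬ Conn ends ω' a₁ z := fun h => h1 (Or.inr (Or.inr ⟨h, hvv⟩))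
    have h1v : ¬ Conn ends ω' a₁ v := fun h => h1 (Or.inl h)
    have h4z : ¬ Conn ends ω' a₂ z := fun h => h4 (Or.inr (Or.inr ⟨h, hvv⟩))
    have h4v : ¬ Conn ends ω' a₂ v := fun h => h4 (Or.inl h)
    have h3' : ¬ Conn ends ω' a₂ a₁ := fun h => h3 (Or.inl h)
    have h2' : Conn ends ω' a₁ y := by
      rcases h2 with h | ⟨h5, _⟩ | ⟨h5, _⟩
      · exact h
      · exact absurd h5 h1v
      · exact absurd h5 h1z
    exact ⟨⟨⟨⟨h1v, h2'⟩, h3', h4v⟩, h1z⟩, h4z⟩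
  · rintro ⟨⟨⟨⟨h1v, h2⟩, h3, h4v⟩, h1z⟩, h4z⟩
    refine ⟨⟨?_, Or.inl h2⟩, ?_, ?_⟩
    · rintro (h | ⟨h5, _⟩ | ⟨h5, _⟩)
      · exact h1v h
      · exact h1v h5
      · exact h1z h5
    · rintro (h | ⟨h5, _⟩ | ⟨h5, _⟩)
      · exact h3 h
      · exact h4v h5
      · exact h4z h5
    · rintro (h | ⟨h5, _⟩ | ⟨h5, _⟩)
      · exact h4v h
      · exact h4v h5
      · exact h4z h5

omit [Fintype V] [IsStrictOrderedRing R] in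
/-- `P¹((0,1)) = P⁰((0,1) ∩ {a₁ ↮ z} ∩ {a₂ ↮ z})`. -/
lemma prob_cls01_vfar {x z : V} (hends : ends e = s(x, z)) (hx : x ∈ root p ends v)
    (he : p e ≠ 1) :
    prob (Function.update p e 1) (cls01 ends a₁ a₂ v y) =
      prob (Function.update p e 0)
        (cls01 ends a₁ a₂ v y ∩ (connEvent ends a₁ z)ᶜ ∩ (connEvent ends a₂ z)ᶜ) :=
  prob_update_one_eq_update_zero_of_iff he (cls01_dict_vfar hends hx he)

end Dict

section Drop

variable {p : E → R} {ends : E → Sym2 V} {a₁ a₂ v y : V}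

omit [Fintype E] [DecidableEq E] [Fintype V] in
/-- `(0,1) ⊆ N`. -/
lemma cls01_subset_N : cls01 ends a₁ a₂ v y ⊆ N ends a₁ a₂ v := by
  rw [cls01_eq_inter]
  exact Set.inter_subset_right

/-- **The `(0,1)`-share of `N` does not rise when the far end `z` joins the avoided set**:
`P((0,1) ∩ {a₁ ↮ z} ∩ {a₂ ↮ z}) · P(N) ≤ P((0,1)) · P(N ∩ {a₁ ↮ z})` — van den Berg–Häggström–Kahn
(`bhk_part_ineq` with `z` in the role of `b`: `P((0,1))·P(z ∈ C₁, N) ≤ P((0,1), z ∈ C₁)·P(N)`)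
and the two complement identities. -/
theorem cls01_drop_ineq (hp : IsProbVec p) (z : V) :
    prob p (cls01 ends a₁ a₂ v y ∩ (connEvent ends a₁ z)ᶜ ∩ (connEvent ends a₂ z)ᶜ) *
        prob p (N ends a₁ a₂ v) ≤
      prob p (cls01 ends a₁ a₂ v y) * prob p (N ends a₁ a₂ v ∩ (connEvent ends a₁ z)ᶜ) := by
  have hB := bhk_part_ineq (p := p) (ends := ends) (a₁ := a₁) (a₂ := a₂) (b := z) (v := v)
    (y := y) hp
  have hc1 := prob_inter_add_prob_inter_compl p (cls01 ends a₁ a₂ v y) (connEvent ends a₁ z)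
  have hc2 := prob_inter_add_prob_inter_compl p (N ends a₁ a₂ v) (connEvent ends a₁ z)
  have hsub : prob p (cls01 ends a₁ a₂ v y ∩ (connEvent ends a₁ z)ᶜ ∩ (connEvent ends a₂ z)ᶜ) ≤
      prob p (cls01 ends a₁ a₂ v y ∩ (connEvent ends a₁ z)ᶜ) :=
    prob_mono hp Set.inter_subset_left
  have hXN : prob p (connEvent ends a₁ z ∩ N ends a₁ a₂ v) =
      prob p (N ends a₁ a₂ v ∩ connEvent ends a₁ z) := by rw [Set.inter_comm]
  have hN := prob_nonneg hp (N ends a₁ a₂ v)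
  have hO := prob_nonneg hp (cls01 ends a₁ a₂ v y)
  rw [hXN] at hB
  nlinarith [hB, hc1, hc2, hsub, hN, hO, mul_le_mul_of_nonneg_right hsub hN]

end Drop

/-! ## The theorem -/

section Step

variable {p : E → R} {ends : E → Sym2 V} {a₁ a₂ b v y : V} {e : E}

omit [Fintype E] [DecidableEq E] [Fintype V] [DecidableEq V] in
/-- `U ∩ Y ∩ X ∩ Ω ⊆ U ∩ Y ∩ Ω`. -/
lemma UYXΩ_subset_UYΩ :
    connEvent ends a₁ v ∩ connEvent ends a₂ y ∩ connEvent ends a₁ b ∩ Ω ends a₁ a₂ ⊆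
      connEvent ends a₁ v ∩ connEvent ends a₂ y ∩ Ω ends a₁ a₂ := fun _ h => ⟨h.1.1, h.2⟩

omit [Fintype V] in
/-- With `P(Y ∩ S) = 0`, the cleared form at any threshold pair is `P(S)·(O1e·D₀ − N₀·O1)`. -/
lemma kprimeForm_of_YS_eq_zero (hp : IsProbVec p)
    (hYS : prob p (connEvent ends a₂ y ∩ S ends a₁ a₂ v) = 0) (N₀ D₀ : R) :
    kprimeForm ends a₁ a₂ b v y p N₀ D₀ =
      prob p (S ends a₁ a₂ v) *
        (prob p (cls01e ends a₁ a₂ b v y) * D₀ - N₀ * prob p (cls01 ends a₁ a₂ v y)) := by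
  have hD : prob p (connEvent ends a₁ v ∩ connEvent ends a₂ y ∩ Ω ends a₁ a₂) = 0 := by
    apply le_antisymm _ (prob_nonneg hp _)
    rw [← hYS]
    exact prob_mono hp UYΩ_subset_YS
  have hC : prob p (connEvent ends a₁ v ∩ connEvent ends a₂ y ∩ connEvent ends a₁ b ∩
      Ω ends a₁ a₂) = 0 := by
    apply le_antisymm _ (prob_nonneg hp _)
    rw [← hD]
    exact prob_mono hp UYXΩ_subset_UYΩ
  unfold kprimeForm
  rw [hYS, hD, hC]
  ring

omit [Fintype E] [DecidableEq E] [Fintype V] [DecidableEq V] in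
/-- **The algebra of `(STEP-v)₁` in the regime `P(Y ∩ S) = 0`** (plain ring variables: the parent's
masses `D0, N0, O1, O1e` are the `t`-mixtures of the world-`0` masses `D00, N00, O10, O1e0` and the
world-`1` masses `D01, N01, O11, O1e1`; `c1X = P¹((0,1) ∩ X)`):
`(1 − t)·D0·Sm·S0·(O1e0·D00 − N00·O10) ≤ D00·S0·Sm·(O1e·D0 − N0·O1)`, because the difference is
`t·S0·Sm·[D00·(D0·O1e1 − N0·O11) + (1 − t)·O10·(N00·D01 − N01·D00)]` and the bracket is `≥ 0` by the
three signed facts `hB1` (world `1` at its own lean), `hΛ` (the lean drop) and `hM` (the `(0,1)`-share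
of `N` does not rise). -/
lemma stepOne_algebra {t S0 Sm D0 N0 O1 O1e D00 N00 O10 O1e0 D01 N01 O11 O1e1 c1X : R}
    (ht0 : 0 < t) (ht1 : 0 < 1 - t)
    (hD0 : D0 = t * D01 + (1 - t) * D00) (hN0 : N0 = t * N01 + (1 - t) * N00)
    (hO1 : O1 = t * O11 + (1 - t) * O10) (hO1e : O1e = t * O1e1 + (1 - t) * O1e0)
    (hD00n : 0 ≤ D00) (hD01n : 0 ≤ D01) (_hO10n : 0 ≤ O10) (hO11n : 0 ≤ O11)
    (hO1e1n : 0 ≤ O1e1) (hN01n : 0 ≤ N01) (hS0n : 0 ≤ S0) (hSmn : 0 ≤ Sm)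
    (hO11D : O11 ≤ D01) (hO1e1O : O1e1 ≤ O11) (hN01D : N01 ≤ D01)
    (hB1 : O11 * N01 ≤ c1X * D01) (hc1X : c1X ≤ O1e1)
    (hΛ : N01 * D00 ≤ N00 * D01) (hM : O11 * D00 ≤ O10 * D01) :
    (1 - t) * D0 * Sm * (S0 * (O1e0 * D00 - N00 * O10)) ≤
      D00 * S0 * (Sm * (O1e * D0 - N0 * O1)) := by
  have hD0n : 0 ≤ D0 := by
    rw [hD0]; exact add_nonneg (mul_nonneg ht0.le hD01n) (mul_nonneg ht1.le hD00n)
  have key : D00 * S0 * (Sm * (O1e * D0 - N0 * O1)) -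
      (1 - t) * D0 * Sm * (S0 * (O1e0 * D00 - N00 * O10)) =
      t * S0 * Sm * (D00 * (D0 * O1e1 - N0 * O11) +
        (1 - t) * O10 * (N00 * D01 - N01 * D00)) := by
    subst hD0 hN0 hO1 hO1e
    ring
  have hΛn : 0 ≤ N00 * D01 - N01 * D00 := sub_nonneg.2 hΛ
  have hMn : 0 ≤ O10 * D01 - D00 * O11 := by linarith [hM]
  have hbr : 0 ≤ D00 * (D0 * O1e1 - N0 * O11) + (1 - t) * O10 * (N00 * D01 - N01 * D00) := by
    rcases hD01n.eq_or_lt with h | h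
    · -- `P¹(N) = 0`: the world-`1` masses vanish
      have e1 : O11 = 0 := le_antisymm (h ▸ hO11D) hO11n
      have e2 : O1e1 = 0 := le_antisymm (e1 ▸ hO1e1O) hO1e1n
      have e3 : N01 = 0 := le_antisymm (h ▸ hN01D) hN01n
      rw [e1, e2, e3, ← h]
      ring_nf
      exact le_rfl
    · -- `P¹(N) > 0`: multiply the bracket by it
      have hmix : D0 * N01 - N0 * D01 = -((1 - t) * (N00 * D01 - N01 * D00)) := by
        rw [hD0, hN0]; ring
      have hB1' : O11 * N01 ≤ D01 * c1X := by linarith [hB1, mul_comm c1X D01]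
      have h1 : D0 * (O11 * N01) ≤ D0 * (D01 * c1X) := mul_le_mul_of_nonneg_left hB1' hD0n
      have h2 : D0 * (D01 * c1X) ≤ D0 * (D01 * O1e1) :=
        mul_le_mul_of_nonneg_left (mul_le_mul_of_nonneg_left hc1X hD01n) hD0n
      have hA : 0 ≤ D00 * (D0 * (D01 * O1e1) - D0 * (O11 * N01)) :=
        mul_nonneg hD00n (sub_nonneg.2 (le_trans h1 h2))
      have hBC : 0 ≤ (1 - t) * (N00 * D01 - N01 * D00) * (O10 * D01 - D00 * O11) :=
        mul_nonneg (mul_nonneg ht1.le hΛn) hMn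
      have hid : D01 * (D00 * (D0 * O1e1 - N0 * O11) +
          (1 - t) * O10 * (N00 * D01 - N01 * D00)) =
          D00 * (D0 * (D01 * O1e1) - D0 * (O11 * N01)) + D00 * O11 * (D0 * N01 - N0 * D01) +
            D01 * ((1 - t) * O10 * (N00 * D01 - N01 * D00)) := by
        ring
      have h3 : 0 ≤ D01 * (D00 * (D0 * O1e1 - N0 * O11) +
          (1 - t) * O10 * (N00 * D01 - N01 * D00)) := by
        rw [hid, hmix]
        have hid2 : D00 * O11 * -((1 - t) * (N00 * D01 - N01 * D00)) +
            D01 * ((1 - t) * O10 * (N00 * D01 - N01 * D00)) =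
            (1 - t) * (N00 * D01 - N01 * D00) * (O10 * D01 - D00 * O11) := by ring
        linarith [hA, hBC, hid2]
      exact (mul_nonneg_iff_of_pos_left h).1 h3
  have hfin : 0 ≤ t * S0 * Sm * (D00 * (D0 * O1e1 - N0 * O11) +
      (1 - t) * O10 * (N00 * D01 - N01 * D00)) :=
    mul_nonneg (mul_nonneg (mul_nonneg ht0.le hS0n) hSmn) hbr
  linarith [key, hfin]

/-- **`(STEP-v)₁` at every `v`-root edge when `P(Y ∩ S) = 0`**: for `e = {x, z}` with `x` in the
root of `v`, `p e ∉ {0, 1}` and `a₂` unable to reach `y` inside `S`,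
`(1 − t)·P(N)·P(S)·form(p[e ↦ 0]) ≤ P⁰(N)·P⁰(S)·form(p)`. -/
theorem stepOne_of_YS_eq_zero (hp : IsProbVec p) {x z : V} (hends : ends e = s(x, z))
    (hx : x ∈ root p ends v) (he0 : p e ≠ 0) (he1 : p e ≠ 1)
    (hYS : prob p (connEvent ends a₂ y ∩ S ends a₁ a₂ v) = 0) :
    (1 - p e) * prob p (N ends a₁ a₂ v) * prob p (S ends a₁ a₂ v) *
        kprimeForm ends a₁ a₂ b v y (Function.update p e 0)
          (prob (Function.update p e 0) (connEvent ends a₁ b ∩ N ends a₁ a₂ v))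
          (prob (Function.update p e 0) (N ends a₁ a₂ v)) ≤
      prob (Function.update p e 0) (N ends a₁ a₂ v) * prob (Function.update p e 0) (S ends a₁ a₂ v) *
        kprimeForm ends a₁ a₂ b v y p (prob p (connEvent ends a₁ b ∩ N ends a₁ a₂ v))
          (prob p (N ends a₁ a₂ v)) := by
  have hp0 : IsProbVec (Function.update p e 0) := hp.update e le_rfl zero_le_one
  have hp1 : IsProbVec (Function.update p e 1) := hp.update e zero_le_one le_rfl
  have ht0 : 0 < p e := lt_of_le_of_ne (hp.nonneg e) (Ne.symm he0)
  have ht1 : 0 < 1 - p e := sub_pos.2 (lt_of_le_of_ne (hp.le_one e) he1)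
  -- `P(Y ∩ S) = 0` in world `0`
  have hYS0 : prob (Function.update p e 0) (connEvent ends a₂ y ∩ S ends a₁ a₂ v) = 0 := by
    have hYSp := prob_eq_pin p (connEvent ends a₂ y ∩ S ends a₁ a₂ v) e
    have h0 := prob_nonneg hp0 (connEvent ends a₂ y ∩ S ends a₁ a₂ v)
    have h1 := prob_nonneg hp1 (connEvent ends a₂ y ∩ S ends a₁ a₂ v)
    have ha : 0 ≤ p e * prob (Function.update p e 1) (connEvent ends a₂ y ∩ S ends a₁ a₂ v) :=
      mul_nonneg ht0.le h1
    have hb : (1 - p e) * prob (Function.update p e 0) (connEvent ends a₂ y ∩ S ends a₁ a₂ v) =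
        0 := by linarith [hYSp, hYS, ha, mul_nonneg ht1.le h0]
    exact (mul_eq_zero.1 hb).resolve_left ht1.ne'
  rw [kprimeForm_of_YS_eq_zero hp hYS, kprimeForm_of_YS_eq_zero hp0 hYS0]
  -- (i) world 1 at its own lean
  have hB1 := bhk_part_ineq (p := Function.update p e 1) (ends := ends) (a₁ := a₁) (a₂ := a₂)
    (b := b) (v := v) (y := y) hp1
  have hc1X : prob (Function.update p e 1) (cls01 ends a₁ a₂ v y ∩ connEvent ends a₁ b) ≤
      prob (Function.update p e 1) (cls01e ends a₁ a₂ b v y) :=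
    prob_mono hp1 (Set.inter_subset_inter_right _ Set.subset_union_left)
  -- (ii) the lean drop, through the dictionary
  have hΛ := lean_drop_ineq (p := Function.update p e 0) (ends := ends) (a₁ := a₁) (a₂ := a₂)
    (b := b) (v := v) (y := z) hp0
  have dN := prob_N_vy (a₁ := a₁) (a₂ := a₂) (y := z) hends hx he1
  have dXN := prob_XN_vy (a₁ := a₁) (a₂ := a₂) (b := b) (y := z) hends hx he1
  rw [← dN, ← dXN] at hΛ
  -- (iii) the `(0,1)`-share of `N` does not rise, through the dictionary
  have hM := cls01_drop_ineq (p := Function.update p e 0) (ends := ends) (a₁ := a₁) (a₂ := a₂)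
    (v := v) (y := y) hp0 z
  have dO1 := prob_cls01_vfar (a₁ := a₁) (a₂ := a₂) (y := y) hends hx he1
  rw [← dN, ← dO1] at hM
  exact stepOne_algebra ht0 ht1 (prob_eq_pin p _ e) (prob_eq_pin p _ e) (prob_eq_pin p _ e)
    (prob_eq_pin p _ e) (prob_nonneg hp0 _) (prob_nonneg hp1 _) (prob_nonneg hp0 _)
    (prob_nonneg hp1 _) (prob_nonneg hp1 _) (prob_nonneg hp1 _) (prob_nonneg hp0 _)
    (prob_nonneg hp _) (prob_mono hp1 cls01_subset_N) (prob_mono hp1 Set.inter_subset_left)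
    (prob_mono hp1 Set.inter_subset_right) hB1 hc1X hΛ hM

end Step

end KPrime

end Summit.Ventures.PercRepro2
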